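import Literature.AnabelianGeometry.SemiGraphs.TemperedAnabelianWitness
import Summits.ABC.IUTFork.LanaKummerTemperedTower
import HarnessLib

/-!
# L-LANA objects XII octies: non-vacuity of the tempered Kummer statements — the instance `Π := G_{ℚ_p}`

Vacuity-audit companion (D-0012; seat abc-iut-c312-4 gen 3, re-filed by gen 5 without the duplicate of
`TemperedCurve.degenerate_isEmpty_pt`; L-LANA level) of `LanaKummerTempered.lean` /
`LanaKummerTemperedTower.lean`; TAKES NO SIDE on [IUTchIII] Cor. 3.12. Those files prove, for EVERY `X : TemperedCurve p`
(layer L3's interface), that the Kummer embedding `K^× ↪ H¹(Π^temp_{X_K}, Λ(ℚ̄_p^×))` and the Kummer towers over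
`Π^temp_{X_K}` and over each decomposition group are injective with no hypothesis. Since
`Literature/AnabelianGeometry/SemiGraphs/TemperedAnabelianWitness.lean` (this seat, vacuity lane) exhibits the
degenerate inhabitant `TemperedCurve.degenerate p` (`K := ℚ_p`, `Π^temp := G_{ℚ_p}`, identity augmentation), the
universally quantified theorems are NOT vacuous, and their instance at the witness is classical Kummer theory of
`ℚ_p` itself, now kernel theorems:

* `padic_kummerEmbedding_injective` — `ℚ_p^× = (⊥ : IntermediateField ℚ_p ℚ̄_p)^× ↪ H¹(G_{ℚ_p}, Λ(ℚ̄_p^×))`;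
* `padic_kummerTower_injective` — **`ℚ̄_p^× ↪ lim_{→ U ⊴ G_{ℚ_p} open} H¹(U, Λ(ℚ̄_p^×))`**, the full Kummer tower of
  `ℚ̄_p/ℚ_p`, injective (LANA §6.1's `κ` for `G := G_{ℚ_p}`, `M := ℚ̄_p^×`);
* `padic_kummerTowerInt_injective` — its restriction to `O^▷_{ℚ̄_p}` (§6.2 (g)'s `κ_t` shape).

[cite: LANA2026Report, §6.1 pp. 31–32, §4.2 (b) p. 26] NOT here: any judgement; the witness is not a curve.
-/

noncomputable section

namespace Summit.ABC
namespace IUTFork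
namespace TemperedCurveRef

open Literature.AnabelianGeometry.SemiGraphs

variable (p : ℕ) [Fact p.Prime]

/-- The augmentation of the degenerate witness is the identity of `G_{ℚ_p}`. [cite: MochizukiSemiAnbd2006, §6 p.69] -/
theorem rho_degenerate : rho (TemperedCurve.degenerate p) = MonoidHom.id (GQp p) := rfl

/-- **Non-vacuity / `ℚ_p` instance of `kummerEmbedding_injective`**: the Kummer embedding
`ℚ_p^× ↪ H¹(G_{ℚ_p}, Λ(ℚ̄_p^×))` (base field `⊥ = ℚ_p` of the witness) is injective. [cite: LANA2026Report, §4.2 (b) p. 26] -/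
theorem padic_kummerEmbedding_injective :
    Function.Injective (kummerEmbedding (TemperedCurve.degenerate p)) :=
  kummerEmbedding_injective (TemperedCurve.degenerate p)

/-- **Non-vacuity / `ℚ_p` instance of `kummerTowerPi_injective`**: the Kummer tower
`ℚ̄_p^× → lim_{→ U} H¹(U, Λ(ℚ̄_p^×))` over the open normal subgroups `U ⊴ G_{ℚ_p}` is injective on ALL of `ℚ̄_p^×`.
[cite: LANA2026Report, §6.1 p. 31] -/
theorem padic_kummerTower_injective :
    Function.Injective (kummerTowerPi (TemperedCurve.degenerate p)) :=
  kummerTowerPi_injective (TemperedCurve.degenerate p)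

/-- … and so is its restriction to the integral monoid `O^▷_{ℚ̄_p}`. [cite: LANA2026Report, §6.2 (g) p. 35] -/
theorem padic_kummerTowerInt_injective :
    Function.Injective (kummerTowerIntPi (TemperedCurve.degenerate p)) :=
  kummerTowerIntPi_injective (TemperedCurve.degenerate p)

/-- `κ(a) = 0 ⟺ a = 1` for every `a ∈ ℚ̄_p^×` in the `G_{ℚ_p}`-tower. [cite: LANA2026Report, §6.1 p. 31] -/
theorem padic_kummerTower_eq_zero_iff (a : Ambient.ViaUnits (rho (TemperedCurve.degenerate p))) :
    kummerTowerPi (TemperedCurve.degenerate p) (Additive.ofMul a) = 0 ↔ a = 1 :=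
  kummerTowerPi_eq_zero_iff (TemperedCurve.degenerate p) a

-- The witness has no closed points (`TemperedCurve.degenerate_isEmpty_pt`, the witness file), so the
-- decomposition-group statements (`kummerTowerDecomp_injective`, …) have no instance there: nobody should read the
-- `D_x` theorems as exercised by this file.

end TemperedCurveRef

end IUTFork

end Summit.ABC

end
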